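import Literature.MathematicalPhysics.QuantumFieldTheory.Balaban1983to89.B15RopTotal
import Literature.MathematicalPhysics.QuantumFieldTheory.Balaban1983to89.Node00.DatumAvLayer

/-!
# NODE 00 — DEFINER ₇, FILE 2: Bałaban's renormalisation operation `R` AS A TOTAL DEFINITION OF RECORD filling
# `Residual₅.R`, with `preservesIntegral_R` ((0.4) [IV]) and `integrable_R` THEOREMS for every density — v1: the operation
# (0.3) [IV] p. 176 on the represented tower of record, the identity elsewhere (chair R434 (c1); fork (B), node00-def l.9324)

Seat `pub-ymgap-node00-def-R` (DEFINER ₇).  [IV] = [Balaban1989LargeFieldI], [B16] = [Balaban1989LargeFieldII], [III] =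
[Balaban1988Convergent].

WHAT THIS FILE IS.  Print defines `R` only on REPRESENTED densities ((0.2) p. 176 «ρ(V) = Σ_Z ρ(Z, V)»; §1 p. 177: each term of
the expansion (2.18) [III]); the three printed layers — the schematic (0.3), the basic step 𝐑′ (1.100) p. 201 (*"not a complete
𝐑-operation yet, but … a basic part of it"*), and the complete operation (1.70)–(1.72) [B16] p. 378–379 — differ in the DATUM they
act on, not in shape.  Accordingly `R` of record is ONE shape: n12-b's LANDED total operator `B15RopTotal.ropTotal` (p410333) applied
to a REPRESENTATION-EXTRACTION datum `rep p k : Density → RepData` — the new, smaller residual of stage ₇ (`RepOfRecord`), to be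
PINNED by the represented tower of record (₇b; v2 = r12's `RPrimeData`∕`rPrime1100` for (1.100), v3 = + [B16] (1.70)–(1.72) with
the operations `T′_k(X)` as DATA).  On a density that IS the represented one and whose pieces satisfy the provisos of p. 176
(*"the densities are positive, … the denominators are positive"*), `R` of record is (0.3); elsewhere it is the identity (typing
convention «Bałaban's R on the represented tower, conventional elsewhere», R434 (c1)).  CONSEQUENCE: the two property fields of
`Residual₅` are THEOREMS for every density and every datum (`preservesIntegral_ROp03OfRecord`, `integrable_ROp03OfRecord`, from
`B15RopTotal.preservesIntegral_ropTotal ∕ integrable_ropTotal`, i.e. b01's (0.4) `B15.BasicStep.preservesIntegral_of_rop`).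
§3 offers the positivity ESTIMATE of print as ONE DISPLAYED admissibility clause on the pinned objects (`TowerProvisos`,
R434 (c1): «ESTIMATE ASSUMED AS ADMISSIBILITY — discharge source [IV] §1 positivity; GAPS row owed») for node00-def's
`Stage7Params.Admissible`, should the record want «R = print's formula on the whole tower» rather than the identity fallback.
§4 types the trivial one-region representation (the explicit «no representation read yet» CONVENTION, under which `R` of
record is the identity on every density — labelled as such; node00-def decides whether to plug it or keep `rep` residual).

NAMING (node00-def DEFINER-SPEC-g28 §2 (r0)): v1 = the §0 form (0.3) instantiated carries the name `ROp03OfRecord`; the name `ROfRecord` is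
reserved for the §1 ∕ [B16] (1.72) version (v2∕v3, append-only successors acting on the richer datum).

WHAT THIS FILE IS NOT.  No representation is constructed here; no positivity, no bound, nothing of Bałaban's is asserted;
(1.100)∕(1.72) are the append-only successors v2∕v3.  No `instance`, no `notation`, no `sorry`.  HONEST FRAMING: definitions of
record + kernel bookkeeping; counts unmoved; NOT continuum ∕ OS ∕ mass-gap ∕ Clay.
-/

noncomputable section

open MeasureTheory
open scoped BigOperators

namespace Literature.MathematicalPhysics.QuantumFieldTheory.Balaban1983to89.Node00

open T4Continuum B15RopTotal
open B15.BasicStep (fibreIntegral normTerm RopReal)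

/-! ## §1  The stage-₇ residual and `R` of record -/

variable (F : T4Family) (N : ℕ) [NeZero N]

/-- **The representation-extraction datum** (the residual of stage ₇, smaller than `Residual₅.R`): for each run `p` and step
`k`, the (0.2)-representation `ρ(V) = Σ_Z ρ(Z, V)` ([IV] p. 176; the terms of the expansion (2.18) [III]) READ AT a density of
`T^{(k+1)}` — the represented tower of record evaluated there (to be pinned by ₇b; conventional where the density is not the
tower's). [cite: Balaban1989LargeFieldI, (0.2) p.176] -/
abbrev RepOfRecord : Type 1 :=
  (p : B12.RunParams) → (k : ℕ) → Density (F.P p.K) (k + 1) (SU N) → RepData (F.P p.K) (k + 1) (SU N)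

open Classical in
/-- **`R` OF RECORD (v1)** — [IV] (0.3) p. 176, verbatim: *"(𝐑ρ)(V) = Σ_Z ρ(Z″, V) ∫dV⌈_{Z′} ρ(Z, V) [∫dV⌈_{Z′} ρ(Z″, V)]⁻¹"* on
the represented tower of record, the identity elsewhere: n12-b's total operator `B15RopTotal.ropTotal` at the datum `rep p k`
(fills `Residual₅.R`; Mathlib's `x∕0 = 0` inside, no guards). [cite: Balaban1989LargeFieldI, (0.3) p.176] -/
def ROp03OfRecord (rep : RepOfRecord F N) (p : B12.RunParams) (k : ℕ) :
    Density (F.P p.K) (k + 1) (SU N) → Density (F.P p.K) (k + 1) (SU N) :=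
  ropTotal (rep p k)

open Classical in
/-- Unfolding: `R` of record is `ropTotal` at the datum. [cite: Balaban1989LargeFieldI, (0.3) p.176 (bookkeeping)] -/
theorem ROp03OfRecord_eq (rep : RepOfRecord F N) (p : B12.RunParams) (k : ℕ) :
    ROp03OfRecord F N rep p k = ropTotal (rep p k) := rfl

open Classical in
/-- The printed branch: on a density that is the represented one with the provisos of p. 176, `R` of record is (0.3) of its
representation. [cite: Balaban1989LargeFieldI, (0.3) p.176] -/
theorem ROp03OfRecord_of_admissible {rep : RepOfRecord F N} {p : B12.RunParams} {k : ℕ}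
    {ρ : Density (F.P p.K) (k + 1) (SU N)} (h : Admissible (rep p k) ρ) :
    ROp03OfRecord F N rep p k ρ = (rep p k ρ).rop :=
  ropTotal_of_admissible h

open Classical in
/-- The conventional branch: off the represented tower (or off the provisos) `R` of record is the identity.
[cite: Balaban1989LargeFieldI, (0.3) p.176 (typing convention)] -/
theorem ROp03OfRecord_of_not {rep : RepOfRecord F N} {p : B12.RunParams} {k : ℕ}
    {ρ : Density (F.P p.K) (k + 1) (SU N)} (h : ¬ Admissible (rep p k) ρ) :
    ROp03OfRecord F N rep p k ρ = ρ :=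
  ropTotal_of_not h

/-! ## §2  The two property fields of `Residual₅` as THEOREMS -/

open Classical in
/-- **(0.4) [IV] p. 176 for `R` of record, EVERY density**, verbatim: *"It satisfies the basic normalization property
∫dV(𝐑ρ)(V) = ∫dV ρ(V)"* — in `Residual₅.preservesIntegral_R`'s exact shape (the guard `k < p.K` is not needed).
[cite: Balaban1989LargeFieldI, (0.4) p.176] -/
theorem preservesIntegral_ROp03OfRecord (rep : RepOfRecord F N) :
    ∀ (p : B12.RunParams) (k : ℕ), k < p.K → PreservesIntegral (ROp03OfRecord F N rep p k) :=
  fun p k _ => preservesIntegral_ropTotal (rep p k)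

open Classical in
/-- (0.4) without the step guard. [cite: Balaban1989LargeFieldI, (0.4) p.176] -/
theorem preservesIntegral_ROp03OfRecord' (rep : RepOfRecord F N) (p : B12.RunParams) (k : ℕ) :
    PreservesIntegral (ROp03OfRecord F N rep p k) :=
  preservesIntegral_ropTotal (rep p k)

open Classical in
/-- **`R` of record preserves integrability, EVERY density** — `Residual₅.integrable_R`'s exact shape.
[cite: Balaban1989LargeFieldI, (0.3)–(0.4) p.176 (bookkeeping)] -/
theorem integrable_ROp03OfRecord (rep : RepOfRecord F N) :
    ∀ (p : B12.RunParams) (k : ℕ), k < p.K → ∀ ρ : Density (F.P p.K) (k + 1) (SU N),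
      Integrable ρ (fieldMeasure (F.P p.K) (k + 1) (SU N)) →
        Integrable (ROp03OfRecord F N rep p k ρ) (fieldMeasure (F.P p.K) (k + 1) (SU N)) :=
  fun p k _ _ hρ => integrable_ropTotal (rep p k) hρ

open Classical in
/-- `R` of record is nonnegative on the printed branch. [cite: Balaban1989LargeFieldI, (0.3) p.176 (bookkeeping)] -/
theorem ROp03OfRecord_nonneg {rep : RepOfRecord F N} {p : B12.RunParams} {k : ℕ}
    {ρ : Density (F.P p.K) (k + 1) (SU N)} (h : Admissible (rep p k) ρ) (V : GaugeField (F.P p.K) (k + 1) (SU N)) :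
    0 ≤ ROp03OfRecord F N rep p k ρ V :=
  ropTotal_nonneg h V

/-! ## §3  The positivity estimate of print as ONE displayed admissibility clause (R434 (c1)) -/

open Classical in
/-- **ESTIMATE ASSUMED AS ADMISSIBILITY — discharge source [IV] §1 positivity; GAPS row owed.**  [IV] p. 176 l. 14–16, verbatim:
*"We will prove that the densities are positive, and the in[t]egration domains in the integrals above are nonempty, hence the
denominators are positive, and the operation 𝐑 is well defined."* — as a clause on the PINNED objects: along the tower of
record, every density that is the represented one has pieces satisfying the provisos of `B15RopTotal.RepData.Provisos`
(measurable, ≥ 0, bounded, denominators nowhere 0), so that `R` of record IS (0.3) there (`ROp03OfRecord_eq_rop_of_towerProvisos`).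
For the (1.100) datum (v2) this clause is PROVABLE ((1.101) p. 201: the denominators are Haar integrals of (axial δ)·χ(Λ_i)·
exp(−action) over a set containing a neighbourhood of `V′ = 1`). Offered for `Stage7Params.Admissible`; never a field.
[cite: Balaban1989LargeFieldI, p.176 (positivity of the denominators)] -/
def TowerProvisos (rep : RepOfRecord F N) : Prop :=
  ∀ (p : B12.RunParams) (k : ℕ) (ρ : Density (F.P p.K) (k + 1) (SU N)), (rep p k ρ).total = ρ → (rep p k ρ).Provisos

open Classical in
/-- The positivity half alone, in print's words: the denominators `∫dV⌈_{Z′} ρ(Z″, V)` of (0.3) are nowhere zero along the tower.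
[cite: Balaban1989LargeFieldI, p.176 (positivity of the denominators)] -/
def DenomPos (rep : RepOfRecord F N) : Prop :=
  ∀ (p : B12.RunParams) (k : ℕ) (ρ : Density (F.P p.K) (k + 1) (SU N)), (rep p k ρ).total = ρ →
    letI := (rep p k ρ).fin
    ∀ Z V, fibreIntegral ((rep p k ρ).fib Z) ((rep p k ρ).piece ((rep p k ρ).pp Z)) V ≠ 0

open Classical in
/-- Under the displayed clause, a density that is the represented one is admissible, so `R` of record is (0.3) there.
[cite: Balaban1989LargeFieldI, (0.3) p.176] -/
theorem ROp03OfRecord_eq_rop_of_towerProvisos {rep : RepOfRecord F N} (h : TowerProvisos F N rep) {p : B12.RunParams} {k : ℕ}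
    {ρ : Density (F.P p.K) (k + 1) (SU N)} (hρ : (rep p k ρ).total = ρ) :
    ROp03OfRecord F N rep p k ρ = (rep p k ρ).rop :=
  ROp03OfRecord_of_admissible F N ⟨hρ, h p k ρ hρ⟩

open Classical in
/-- `TowerProvisos` contains `DenomPos`. [cite: Balaban1989LargeFieldI, p.176 (bookkeeping)] -/
theorem denomPos_of_towerProvisos {rep : RepOfRecord F N} (h : TowerProvisos F N rep) : DenomPos F N rep :=
  fun p k ρ hρ => (h p k ρ hρ).2.2.2

/-! ## §4  The trivial representation — the explicit «no representation read» CONVENTION -/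

section Trivial

variable {P : Params} {j : ℕ} {G : Type*} [GaugeGroup G] [MeasurableSpace G] [HaarData G]

/-- The ONE-REGION representation of a density: a single region `Z` with `Z″ = Z`, no bond variables to integrate (`Z′ = ∅`),
piece `ρ` — so `Σ_Z ρ(Z, ·) = ρ` and (0.3) returns `ρ`.  TYPING CONVENTION (labelled): plugging it as `rep` makes `R` of record
the identity on every density (`ROp03OfRecord_trivialRep`). [cite: Balaban1989LargeFieldI, (0.2) p.176 (typing convention)] -/
def trivialRep (ρ : Density P j G) : RepData P j G where
  Region := Unit
  pp := id
  fib := fun _ => ∅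
  piece := fun _ => ρ

omit [MeasurableSpace G] [HaarData G] in
/-- The trivial representation represents `ρ`. [cite: Balaban1989LargeFieldI, (0.2) p.176 (bookkeeping)] -/
theorem trivialRep_total (ρ : Density P j G) : (trivialRep ρ).total = ρ := by
  funext V
  simp [RepData.total, trivialRep]

open Classical in
/-- On the trivial representation the total operator is the identity (both branches return `ρ`).
[cite: Balaban1989LargeFieldI, (0.3) p.176 (typing convention)] -/
theorem ropTotal_trivialRep (ρ : Density P j G) : ropTotal (fun σ : Density P j G => trivialRep σ) ρ = ρ := by
  by_cases h : Admissible (fun σ : Density P j G => trivialRep σ) ρ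
  · rw [ropTotal_of_admissible h]
    obtain ⟨-, -, -, -, hden⟩ := h
    funext V
    have hV : fibreIntegral (∅ : Finset (PBond P j)) ρ V ≠ 0 := hden () V
    have h1 : (trivialRep ρ).rop V = ∑ _Z : Unit, normTerm (∅ : Finset (PBond P j)) ρ ρ V := rfl
    rw [h1, Fintype.sum_unique]
    simp [normTerm, div_self hV]
  · exact ropTotal_of_not h

end Trivial

/-- The trivial representation at every run and step, as a `RepOfRecord`. [cite: Balaban1989LargeFieldI, (0.2) p.176 (typing convention)] -/
def trivialRepOfRecord : RepOfRecord F N := fun _ _ ρ => trivialRep ρ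

open Classical in
/-- Under the «no representation read» convention `R` of record is the identity on every density (labelled CONVENTION; print's
`R` is not the identity — this is the honest extreme of «conventional elsewhere»). [cite: Balaban1989LargeFieldI, (0.3) p.176 (typing convention)] -/
theorem ROp03OfRecord_trivialRep (p : B12.RunParams) (k : ℕ) (ρ : Density (F.P p.K) (k + 1) (SU N)) :
    ROp03OfRecord F N (trivialRepOfRecord F N) p k ρ = ρ :=
  ropTotal_trivialRep ρ

end Literature.MathematicalPhysics.QuantumFieldTheory.Balaban1983to89.Node00

end
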